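import Summits.MatrixMultiplication.OmegaCensus.STPPCriticalPairsZ46APSum

/-!
# ω-census (abelian STPP census): the structure of the `(3,3,2)` blocks of `{(2,2,3),(3,3,2),(3,3,2)}` in `ℤ/46ℤ` (kernel)

HONEST FRAMING (pub-omega census; verbatim): lottery ticket; floor = certified bounds/negative ranges.
Census STRUCTURE (seat pub-omega-stpp-2 gen 32, 2026-08-30), family (b2).  For an STPP family (CKSU Def. 5.1) of the last residual pattern of
order `46` realised in `ℤ/46ℤ`, each `(3,3,2)` block `i ∈ {1,2}` satisfies (N18-tight readings `(A,B,C)`, `(B,C,A)`, `(C,A,B)` ⇒ inner critical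
pairs by `inner_critical_of_n18_tight` ⇒ Kemperman dichotomy of `STPPCriticalPairsZ46.lean`):
* `blockA_structure`: `Aᵢ` and `Y° = ⋃_{k≠i}(C_k − B_k)` are progressions of a common difference `d` (`2d ≠ 0`), OR `Y°` is `K`-periodic and
  `Aᵢ ⊇ {a, a + 23}`;
* `blockB_structure`: the same for `Bᵢ` and `Z° = ⋃_{k≠i}(C_k − A_k)`;
* `blockC_structure`: `Cᵢ = {c, c + d}` and `X° = ⋃_{k≠i}(B_k − A_k)` a `13`-progression of difference `d`, OR `Cᵢ = {c, c + 23}`.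
The clash (no such family exists; computer case map HOME `pub-omega-stpp-2-g32/CASEMAP.md`) is left to successor files.  Nothing here is
progress on `ω`.

References: Kemperman 1960 Thm 2.1 and Kneser 1953 (tree); H. Cohn, R. Kleinberg, B. Szegedy, C. Umans, FOCS 2005 (arXiv:math/0511460), Def. 5.1.
-/

open Finset
open scoped Pointwise

namespace Summit.MatrixMultiplication.OmegaCensus.Z46

open Literature.Combinatorics.Additive

/-! ## §5 Application: the three inner pairs of a `(3,3,2)` block of `{(2,2,3),(3,3,2),(3,3,2)}` in `ℤ/46ℤ` -/

section Blocks

open Literature.Computability.AlgebraicComplexity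
open Summit.MatrixMultiplication.OmegaCensus.STPPKneser
open Summit.MatrixMultiplication.OmegaCensus.CubeNB

variable {A B C : Fin 3 → Finset (ZMod 46)}

/-- `S.image (0 − ·) = −S`. [folklore] -/
theorem image_zero_sub (S : Finset (ZMod 46)) : S.image (fun x => (0 : ZMod 46) - x) = -S := by
  ext x
  simp only [Finset.mem_image, zero_sub, Finset.mem_neg']
  constructor
  · rintro ⟨a, ha, rfl⟩; rwa [neg_neg]
  · intro hx; exact ⟨-x, hx, neg_neg x⟩

/-- `⋃_{k∈I}(A_k − C_k) = −⋃_{k∈I}(C_k − A_k)`. [folklore] -/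
theorem DU_swap (E F : Fin 3 → Finset (ZMod 46)) (I : Finset (Fin 3)) : DU F E I = -(DU E F I) := by
  ext x
  simp only [DU, Finset.mem_biUnion, Finset.mem_neg', mem_D]
  constructor
  · rintro ⟨k, hk, f, hf, e, he, rfl⟩
    exact ⟨k, hk, e, he, f, hf, by abel⟩
  · rintro ⟨k, hk, e, he, f, hf, h⟩
    exact ⟨k, hk, f, hf, e, he, by rw [← neg_neg x, ← h]; abel⟩

/-- `K`-invariance is preserved by negation (`−23 = 23`). [folklore] -/
theorem vadd23_eq_of_neg {X : Finset (ZMod 46)} (h : (23 : ZMod 46) +ᵥ (-X) = -X) : (23 : ZMod 46) +ᵥ X = X := by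
  apply Finset.eq_of_subset_of_card_le _ (by rw [Finset.card_vadd_finset])
  intro x hx
  obtain ⟨y, hy, rfl⟩ := Finset.mem_vadd_finset.1 hx
  have hy' : -y ∈ -X := Finset.neg_mem_neg hy
  have : (23 : ZMod 46) +ᵥ (-y) ∈ (23 : ZMod 46) +ᵥ (-X) := Finset.vadd_mem_vadd_finset hy'
  rw [h, Finset.mem_neg'] at this
  have e : -((23 : ZMod 46) +ᵥ -y) = (23 : ZMod 46) +ᵥ y := by
    simp only [vadd_eq_add, neg_add, neg_neg]
    rw [(by decide : -(23 : ZMod 46) = 23)]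
  rwa [e] at this

/-- Non-emptiness of the nine sets from the card vector. [folklore] -/
private theorem ne_of_cards (hA : ∀ i, #(A i) = ![2, 3, 3] i) (hB : ∀ i, #(B i) = ![2, 3, 3] i) (hC : ∀ i, #(C i) = ![3, 2, 2] i) :
    (∀ i, (A i).Nonempty) ∧ (∀ i, (B i).Nonempty) ∧ (∀ i, (C i).Nonempty) :=
  ⟨fun i => card_pos.1 (by rw [hA]; fin_cases i <;> simp), fun i => card_pos.1 (by rw [hB]; fin_cases i <;> simp),
    fun i => card_pos.1 (by rw [hC]; fin_cases i <;> simp)⟩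

/-- **`A`-structure of a `(3,3,2)` block** (`i = 1, 2`) of an STPP family of pattern `{(2,2,3),(3,3,2),(3,3,2)}` in `ℤ/46ℤ`: EITHER `Aᵢ` and
`Y° = ⋃_{k≠i}(C_k − B_k)` are arithmetic progressions with a common difference `d` of order `23` or `46`, OR `Y°` is `K`-periodic and `Aᵢ`
contains a `K`-coset `{a, a + 23}`. [cite: Kemperman1960, Thm 2.1] [cite: Kneser1953] [cite: CohnKleinbergSzegedyUmans2005, Def. 5.1] -/
theorem blockA_structure (hS : IsSTPP A B C) (hA : ∀ i, #(A i) = ![2, 3, 3] i) (hB : ∀ i, #(B i) = ![2, 3, 3] i)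
    (hC : ∀ i, #(C i) = ![3, 2, 2] i) (i : Fin 3) (hi : i ≠ 0) :
    (∃ d : ZMod 46, 2 • d ≠ 0 ∧ IsAP (A i) d ∧ IsAP (DU B C (univ.erase i)) d) ∨
    ((23 : ZMod 46) +ᵥ DU B C (univ.erase i) = DU B C (univ.erase i) ∧ ∃ a ∈ A i, a + 23 ∈ A i) := by
  obtain ⟨hAne, hBne, hCne⟩ := ne_of_cards hA hB hC
  have hAi : #(A i) = 3 := by rw [hA]; fin_cases i <;> simp at hi ⊢
  have hBi : #(B i) = 3 := by rw [hB]; fin_cases i <;> simp at hi ⊢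
  have hCi : #(C i) = 2 := by rw [hC]; fin_cases i <;> simp at hi ⊢
  have hI : (univ.erase i : Finset (Fin 3)).Nonempty := ⟨0, Finset.mem_erase.2 ⟨hi.symm, Finset.mem_univ _⟩⟩
  have hL : ∑ k ∈ univ.erase i, #(B k) * #(C k) = 12 := by
    fin_cases i <;> simp at hi ⊢ <;> simp only [hB, hC] <;> decide
  have hz : ∑ k ∈ univ.erase i, #(A k) * #(C k) = 12 := by
    fin_cases i <;> simp at hi ⊢ <;> simp only [hA, hC] <;> decide
  have h14 := inner_critical_of_n18_tight hS hAne hBne hCne i hI (ZMod.card 46) (a := 3) (b := 3) (vol := 18) (L := 12) (z := 12)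
    hAi hBi (by rw [hAi, hBi, hCi]) hL hz (by decide)
  set S := (A i).image (fun x => (0 : ZMod 46) - x) with hSdef
  set Yo := DU B C (univ.erase i) with hYo
  have hS3 : #S = 3 := by rw [hSdef, Finset.card_image_of_injective _ sub_right_injective, hAi]
  have hY12 : #Yo = 12 := by rw [hYo, card_DU_BC hS hAne, hL]
  rcases isAP_or_vadd23_of_critical (A := S) (B := Yo) (by omega) (by omega) (by omega) (by omega) ⟨7, by rw [h14]⟩ with
    ⟨d, p, hp⟩ | hper
  · rw [h14] at hp
    have h14' : #(apFinset p d 14) = 14 := by rw [← hp, h14]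
    obtain ⟨hSap, hYap⟩ := isAP_of_add_eq_apFinset_three hS3 hY12 hp h14'
    refine Or.inl ⟨d, two_nsmul_ne_zero_of_card_apFinset p d h14', ?_, hYap⟩
    have h := hSap.neg
    rwa [hSdef, image_zero_sub, neg_neg] at h
  · obtain ⟨hY, s, hs, hs'⟩ := vadd23_and_coset_of_periodic_sum hS3 hY12 h14 hper
    refine Or.inr ⟨hY, ?_⟩
    rw [hSdef, Finset.mem_image] at hs hs'
    obtain ⟨a, ha, rfl⟩ := hs
    obtain ⟨a', ha', he⟩ := hs'
    refine ⟨a', ha', ?_⟩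
    have e : a' + 23 = a := by linear_combination (-1 : ZMod 46) * he
    rw [e]; exact ha

/-- **`B`-structure of a `(3,3,2)` block** (reading `(B,C,A)`): EITHER `Bᵢ` and `Z° = ⋃_{k≠i}(C_k − A_k)` are progressions with a common
difference of order `23` or `46`, OR `Z°` is `K`-periodic and `Bᵢ` contains a `K`-coset. [cite: Kemperman1960, Thm 2.1] [cite: Kneser1953]
[cite: CohnKleinbergSzegedyUmans2005, Def. 5.1] -/
theorem blockB_structure (hS : IsSTPP A B C) (hA : ∀ i, #(A i) = ![2, 3, 3] i) (hB : ∀ i, #(B i) = ![2, 3, 3] i)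
    (hC : ∀ i, #(C i) = ![3, 2, 2] i) (i : Fin 3) (hi : i ≠ 0) :
    (∃ d : ZMod 46, 2 • d ≠ 0 ∧ IsAP (B i) d ∧ IsAP (DU A C (univ.erase i)) d) ∨
    ((23 : ZMod 46) +ᵥ DU A C (univ.erase i) = DU A C (univ.erase i) ∧ ∃ b ∈ B i, b + 23 ∈ B i) := by
  obtain ⟨hAne, hBne, hCne⟩ := ne_of_cards hA hB hC
  have hAi : #(A i) = 3 := by rw [hA]; fin_cases i <;> simp at hi ⊢
  have hBi : #(B i) = 3 := by rw [hB]; fin_cases i <;> simp at hi ⊢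
  have hCi : #(C i) = 2 := by rw [hC]; fin_cases i <;> simp at hi ⊢
  have hI : (univ.erase i : Finset (Fin 3)).Nonempty := ⟨0, Finset.mem_erase.2 ⟨hi.symm, Finset.mem_univ _⟩⟩
  have hL : ∑ k ∈ univ.erase i, #(C k) * #(A k) = 12 := by
    fin_cases i <;> simp at hi ⊢ <;> simp only [hA, hC] <;> decide
  have hz : ∑ k ∈ univ.erase i, #(B k) * #(A k) = 13 := by
    fin_cases i <;> simp at hi ⊢ <;> simp only [hA, hB] <;> decide
  have hS' : IsSTPP B C A := stpp_rotate hS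
  have h14 := inner_critical_of_n18_tight hS' hBne hCne hAne i hI (ZMod.card 46) (a := 3) (b := 2) (vol := 18) (L := 12) (z := 13)
    hBi hCi (by rw [hAi, hBi, hCi]) hL hz (by decide)
  set S := (B i).image (fun x => (0 : ZMod 46) - x) with hSdef
  set T := DU C A (univ.erase i) with hTdef
  have hS3 : #S = 3 := by rw [hSdef, Finset.card_image_of_injective _ sub_right_injective, hBi]
  have hT12 : #T = 12 := by rw [hTdef, card_DU_BC hS' hBne, hL]
  have hTneg : T = -(DU A C (univ.erase i)) := by rw [hTdef, DU_swap]
  rcases isAP_or_vadd23_of_critical (A := S) (B := T) (by omega) (by omega) (by omega) (by omega) ⟨7, by rw [h14]⟩ with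
    ⟨d, p, hp⟩ | hper
  · rw [h14] at hp
    have h14' : #(apFinset p d 14) = 14 := by rw [← hp, h14]
    obtain ⟨hSap, hTap⟩ := isAP_of_add_eq_apFinset_three hS3 hT12 hp h14'
    refine Or.inl ⟨d, two_nsmul_ne_zero_of_card_apFinset p d h14', ?_, ?_⟩
    · have h := hSap.neg
      rwa [hSdef, image_zero_sub, neg_neg] at h
    · have h := hTap.neg
      rwa [hTneg, neg_neg] at h
  · obtain ⟨hT, s, hs, hs'⟩ := vadd23_and_coset_of_periodic_sum hS3 hT12 h14 hper
    refine Or.inr ⟨vadd23_eq_of_neg (by rw [← hTneg]; exact hT), ?_⟩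
    rw [hSdef, Finset.mem_image] at hs hs'
    obtain ⟨b, hb, rfl⟩ := hs
    obtain ⟨b', hb', he⟩ := hs'
    refine ⟨b', hb', ?_⟩
    have e : b' + 23 = b := by linear_combination (-1 : ZMod 46) * he
    rw [e]; exact hb

/-- **`C`-structure of a `(3,3,2)` block** (reading `(C,A,B)`): EITHER `Cᵢ = {c, c + d}` and `X° = ⋃_{k≠i}(B_k − A_k)` is a `13`-term progression
of the same difference `d` (of order `23` or `46`), OR `Cᵢ` is a `K`-coset `{c, c + 23}` (and `Cᵢ + X°` is `K`-periodic).
[cite: Kemperman1960, Thm 2.1] [cite: Kneser1953] [cite: CohnKleinbergSzegedyUmans2005, Def. 5.1] -/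
theorem blockC_structure (hS : IsSTPP A B C) (hA : ∀ i, #(A i) = ![2, 3, 3] i) (hB : ∀ i, #(B i) = ![2, 3, 3] i)
    (hC : ∀ i, #(C i) = ![3, 2, 2] i) (i : Fin 3) (hi : i ≠ 0) :
    (∃ d : ZMod 46, 2 • d ≠ 0 ∧ IsAP (C i) d ∧ IsAP (DU A B (univ.erase i)) d) ∨
    (∃ c : ZMod 46, C i = {c, c + 23}) := by
  obtain ⟨hAne, hBne, hCne⟩ := ne_of_cards hA hB hC
  have hAi : #(A i) = 3 := by rw [hA]; fin_cases i <;> simp at hi ⊢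
  have hBi : #(B i) = 3 := by rw [hB]; fin_cases i <;> simp at hi ⊢
  have hCi : #(C i) = 2 := by rw [hC]; fin_cases i <;> simp at hi ⊢
  have hI : (univ.erase i : Finset (Fin 3)).Nonempty := ⟨0, Finset.mem_erase.2 ⟨hi.symm, Finset.mem_univ _⟩⟩
  have hL : ∑ k ∈ univ.erase i, #(A k) * #(B k) = 13 := by
    fin_cases i <;> simp at hi ⊢ <;> simp only [hA, hB] <;> decide
  have hz : ∑ k ∈ univ.erase i, #(C k) * #(B k) = 12 := by
    fin_cases i <;> simp at hi ⊢ <;> simp only [hB, hC] <;> decide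
  have hS' : IsSTPP C A B := stpp_rotate (stpp_rotate hS)
  have h14 := inner_critical_of_n18_tight hS' hCne hAne hBne i hI (ZMod.card 46) (a := 2) (b := 3) (vol := 18) (L := 13) (z := 12)
    hCi hAi (by rw [hAi, hBi, hCi]) hL hz (by decide)
  set S := (C i).image (fun x => (0 : ZMod 46) - x) with hSdef
  set T := DU A B (univ.erase i) with hTdef
  have hS2 : #S = 2 := by rw [hSdef, Finset.card_image_of_injective _ sub_right_injective, hCi]
  have hT13 : #T = 13 := by rw [hTdef, card_DU_BC hS' hCne, hL]
  rcases isAP_or_vadd23_of_critical (A := S) (B := T) (by omega) (by omega) (by omega) (by omega) ⟨7, by rw [h14]⟩ with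
    ⟨d, p, hp⟩ | hper
  · rw [h14] at hp
    have h14' : #(apFinset p d 14) = 14 := by rw [← hp, h14]
    obtain ⟨hSap, hTap⟩ := isAP_of_add_eq_apFinset_two hS2 hT13 hp h14'
    refine Or.inl ⟨d, two_nsmul_ne_zero_of_card_apFinset p d h14', ?_, hTap⟩
    have h := hSap.neg
    rwa [hSdef, image_zero_sub, neg_neg] at h
  · -- write `S = {c', c' + δ}` and conclude `δ = 23`
    obtain ⟨x, y, hxy, hCeq⟩ := Finset.card_eq_two.1 hCi
    have hSeq : S = {0 - x, 0 - x + (x - y)} := by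
      rw [hSdef, hCeq, Finset.image_insert, Finset.image_singleton]
      congr 1
      rw [zero_sub, zero_sub, Finset.singleton_inj]; abel
    have hδ : x - y ≠ 0 := sub_ne_zero.2 hxy
    rw [hSeq] at h14 hper
    have h23 := eq_23_of_periodic_pair_sum hδ hT13 h14 hper
    refine Or.inr ⟨y, ?_⟩
    rw [hCeq]
    have hx : x = y + 23 := by rw [← h23]; abel
    rw [hx, Finset.pair_comm]

end Blocks

end Summit.MatrixMultiplication.OmegaCensus.Z46
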